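import Literature.Combinatorics.Optimization.ShellLawDeletionComparability
import HarnessLib

/-!
# The re-insertion chain: a `j`-fold edge-deleted shell law is dominated, atom by atom and up to a product of
# `j` constant factors, by the shell law of the original ground set with `f` of the edges re-inserted FULL

Continuation of `ShellLawDeletionComparability.lean` (prover g23: for ONE edge `e = {v, πv} ⊆ S`,
`((t+2−c)/|S|)·law_{S∖e}(t,c; x − |e∩H|) ≤ law_S(t+2,c; x)` — re-inserting `e` as a FULL edge — and
`((|S|−t−c)/|S|)·law_{S∖e}(t,c; x) ≤ law_S(t,c; x)` — re-inserting `e` as an EMPTY edge). Iterating along a chain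
of `π`-stable ground sets `S' = S_j ⊂ S_{j−1} ⊂ ⋯ ⊂ S₀`, one edge at a time, `f` of the `j` deleted edges re-inserted
FULL (each raises the level parameter `t` by `2` and shifts the block count by `|e∩H| ≤ 2`) and `j − f` re-inserted
EMPTY:

* **`shellLaw_reinsertion_le`** (general bases): for `π`-stable `S' ⊆ S₀` with `|S'| + 2j = |S₀|`, `f ≤ j`, and any
  `βF, βE ≥ 0` with `βF·|S₀| ≤ t + 2 − c` and `βE·|S₀| ≤ |S'| + 2 − t − 2f − c` (uniform lower bounds for the one-step
  factors `(t_i+2−c)/|S_i|` resp. `(|S_i|−t_i−c)/|S_i|` along ANY interleaving), there is a shift `w₀ ≤ 2f` (the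
  `H`-weight of the edges re-inserted full) with
  `βF^f · βE^{j−f} · law_{S'}(t,c; x − w₀) ≤ law_{S₀}(t+2f,c; x)` for every `x ∈ ℤ`;
* **`shellLaw_reinsertion_chain`** (the explicit bases): with `0 ≤ t+2−c` and `0 ≤ |S'|+2−t−2f−c`,
  `((t+2−c)/|S₀|)^f · ((|S'|+2−t−2f−c)/|S₀|)^{j−f} · law_{S'}(t,c; x − w₀) ≤ law_{S₀}(t+2f,c; x)`, some `w₀ ≤ 2f`.

This is the constant-loss COMPARABILITY of cell pnp-psdrank's [BULK] blueprint (prover MEMO-26 §7 Step 5; asked by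
prover g24, 2026-08-28): the singleton-window level-smoothing lemma
(`ShellLawSmoothing.sum_abs_nab2_iter_fwdDiff_iter_le`) produces `x`-differences of `2k`-fold deleted laws
`law_{S'}(t−2k, 1; ·)`, which are compared with the undeleted law `law_{univ}(t, 1; ·)` by re-inserting `k` of the
deleted edges full and `k` empty (`S₀ = univ`, `j = 2k`, `f = k`, `c = 1`). For balanced `t` both bases are type
constants, so the loss is `β^{−2k}` and the shift is `w₀ ≤ 2k`.
All PROVED, 0 sorry, no definitions, no named facts; induction on `j` over Rothvoß's slack-matrix combinatorics
[Rothvoß 2017, §2].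

## References
* [Rothvoss2017] T. Rothvoß, *The matching polytope has exponential extension complexity*, J. ACM 64 (2017), §2
  (PDF pp. 5–6): cuts `U`, the partition of a cut by a perfect matching into full / half / empty edges.
* [GodsilMeagher2015] C. Godsil, K. Meagher, *Erdős–Ko–Rado Theorems: Algebraic Approaches* (2015), §15.2
  (perfect matchings as fixed-point-free involutions).
-/

noncomputable section

open Finset

namespace Literature.Combinatorics.Optimization

namespace ShellStep

variable {n : ℕ} {π : Fin n → Fin n}

section Reinsertion

variable (hπ : ∀ v, π (π v) = v) (hπ' : ∀ v, π v ≠ v)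
include hπ hπ'

omit hπ' in
/-- If `S'` is `π`-stable and `v ∉ S'` then `πv ∉ S'`. [cite: GodsilMeagher2015, §15.2] -/
private theorem partner_not_mem {S' : Finset (Fin n)} (hS' : ∀ u ∈ S', π u ∈ S') {v : Fin n} (hv : v ∉ S') :
    π v ∉ S' := fun h => hv (by simpa [hπ v] using hS' _ h)

/-- **THE RE-INSERTION CHAIN, general bases.** For a fixed-point-free involution `π`, `π`-stable `S' ⊆ S₀` with
`|S'| + 2j = |S₀|`, `f ≤ j`, a block `H`, levels `t, c`, and bases `βF, βE ≥ 0` with `βF·|S₀| ≤ t + 2 − c` and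
`βE·|S₀| ≤ |S'| + 2 − t − 2f − c`: there is `w₀ ≤ 2f` with
`βF^f · βE^{j−f} · law_{S'}(t,c; x − w₀) ≤ law_{S₀}(t+2f,c; x)` for every `x ∈ ℤ` — re-insert `f` of the deleted
edges FULL (`shellLaw_sdiff_pair_shift_le`: factor `(t_i+2−c)/|S_i| ≥ βF`, shift `|e∩H| ≤ 2`, level `+2`) and
`j − f` EMPTY (`shellLaw_sdiff_pair_le`: factor `(|S_i|−t_i−c)/|S_i| ≥ βE`), by induction on `j`.
[cite: Rothvoss2017, §2 (PDF p. 6)] -/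
theorem shellLaw_reinsertion_le (H : Finset (Fin n)) (c : ℕ) {βF βE : ℝ} (hβF0 : 0 ≤ βF) (hβE0 : 0 ≤ βE) :
    ∀ (j : ℕ) {S₀ S' : Finset (Fin n)}, (∀ u ∈ S₀, π u ∈ S₀) → (∀ u ∈ S', π u ∈ S') → S' ⊆ S₀ →
      S'.card + 2 * j = S₀.card → ∀ (t f : ℕ), f ≤ j →
      βF * (S₀.card : ℝ) ≤ (t : ℝ) + 2 - c →
      βE * (S₀.card : ℝ) ≤ (S'.card : ℝ) + 2 - t - 2 * f - c →
      ∃ w₀ : ℕ, w₀ ≤ 2 * f ∧ ∀ x : ℤ,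
        βF ^ f * βE ^ (j - f) * shellLaw π S' H t c (x - (w₀ : ℤ)) ≤ shellLaw π S₀ H (t + 2 * f) c x := by
  intro j
  induction j with
  | zero =>
    intro S₀ S' hS₀ hS' hsub hcard t f hf hβF hβE
    have hf0 : f = 0 := by omega
    subst hf0
    have hSS : S' = S₀ := eq_of_subset_of_card_le hsub (by omega)
    subst hSS
    refine ⟨0, le_rfl, fun x => ?_⟩
    simp
  | succ j ih =>
    intro S₀ S' hS₀ hS' hsub hcard t f hf hβF hβE
    -- pick a deleted edge `e = {v, πv} ⊆ S₀ ∖ S'` and peel it off: `S₁ = S₀ ∖ e ⊇ S'`, `|S'| + 2j = |S₁|`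
    have hne : (S₀ \ S').Nonempty := by
      rw [← card_pos, card_sdiff_of_subset hsub]; omega
    obtain ⟨v, hv⟩ := hne
    rw [mem_sdiff] at hv
    obtain ⟨hv₀, hv'⟩ := hv
    have hπv' : π v ∉ S' := partner_not_mem hπ hS' hv'
    have hS₁ : ∀ u ∈ S₀ \ {v, π v}, π u ∈ S₀ \ {v, π v} := sdiff_pair_stable hπ hS₀ v
    have hsub₁ : S' ⊆ S₀ \ {v, π v} := by
      intro u hu
      rw [mem_sdiff, mem_insert, mem_singleton, not_or]
      exact ⟨hsub hu, fun h => hv' (h ▸ hu), fun h => hπv' (h ▸ hu)⟩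
    have hcard₁ : S'.card + 2 * j = (S₀ \ {v, π v}).card := by
      have := card_sdiff_pair hπ' hS₀ hv₀; omega
    have hcard₁le : ((S₀ \ {v, π v}).card : ℝ) ≤ S₀.card := by
      exact_mod_cast card_le_card sdiff_subset
    have hS₀pos : (0 : ℝ) < S₀.card := by exact_mod_cast card_pos.2 ⟨v, hv₀⟩
    have hS'le : (S'.card : ℝ) + 2 ≤ S₀.card := by
      have : S'.card + 2 ≤ S₀.card := by omega
      exact_mod_cast this
    -- the `H`-weight of the peeled edge
    set h : ℕ := (({v, π v} : Finset (Fin n)) ∩ H).card with hh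
    have hh2 : h ≤ 2 := by
      rw [hh]
      exact (card_le_card inter_subset_left).trans (by rw [card_pair (hπ' v).symm])
    by_cases hfj : f = j + 1
    · -- every remaining edge is re-inserted FULL; the peeled one too
      subst hfj
      obtain ⟨w₁, hw₁, hIH⟩ := ih hS₁ hS' hsub₁ hcard₁ t j le_rfl
        (le_trans (mul_le_mul_of_nonneg_left hcard₁le hβF0) hβF)
        (le_trans (mul_le_mul_of_nonneg_left hcard₁le hβE0) (by push_cast at hβE ⊢; linarith))
      refine ⟨w₁ + h, by omega, fun x => ?_⟩
      -- the FULL step at level `t + 2j` on `S₀`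
      have hstep := shellLaw_sdiff_pair_shift_le hπ hπ' hS₀ hv₀ H (t + 2 * j) c x
      have hfac : βF ≤ (((t + 2 * j : ℕ) : ℝ) + 2 - c) / S₀.card := by
        rw [le_div_iff₀ hS₀pos]; push_cast; nlinarith
      have hIHx := hIH (x - (h : ℤ))
      rw [Nat.sub_self, pow_zero, mul_one] at hIHx
      have hlaw0 := shellLaw_nonneg (π := π) (S₀ \ {v, π v}) H (t + 2 * j) c (x - (h : ℤ))
      have hshift : (x - (h : ℤ)) - (w₁ : ℤ) = x - ((w₁ + h : ℕ) : ℤ) := by push_cast; ring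
      rw [show j + 1 - (j + 1) = 0 by omega, pow_zero, mul_one, show t + 2 * (j + 1) = t + 2 * j + 2 by ring,
        ← hshift, pow_succ]
      calc βF ^ j * βF * shellLaw π S' H t c (x - (h : ℤ) - (w₁ : ℤ))
          = βF * (βF ^ j * shellLaw π S' H t c (x - (h : ℤ) - (w₁ : ℤ))) := by ring
        _ ≤ βF * shellLaw π (S₀ \ {v, π v}) H (t + 2 * j) c (x - (h : ℤ)) :=
            mul_le_mul_of_nonneg_left hIHx hβF0
        _ ≤ (((t + 2 * j : ℕ) : ℝ) + 2 - c) / S₀.card *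
              shellLaw π (S₀ \ {v, π v}) H (t + 2 * j) c (x - (h : ℤ)) :=
            mul_le_mul_of_nonneg_right hfac hlaw0
        _ ≤ shellLaw π S₀ H (t + 2 * j + 2) c x := by rw [hh]; exact hstep
    · -- `f ≤ j`: re-insert the peeled edge EMPTY, at the final level `t + 2f`
      have hfj' : f ≤ j := by omega
      obtain ⟨w₁, hw₁, hIH⟩ := ih hS₁ hS' hsub₁ hcard₁ t f hfj'
        (le_trans (mul_le_mul_of_nonneg_left hcard₁le hβF0) hβF)
        (le_trans (mul_le_mul_of_nonneg_left hcard₁le hβE0) hβE)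
      refine ⟨w₁, hw₁, fun x => ?_⟩
      have hstep := shellLaw_sdiff_pair_le hπ hπ' hS₀ hv₀ H (t + 2 * f) c x
      have hfac : βE ≤ ((S₀.card : ℝ) - ((t + 2 * f : ℕ) : ℝ) - c) / S₀.card := by
        rw [le_div_iff₀ hS₀pos]; push_cast; nlinarith
      have hIHx := hIH x
      have hlaw0 := shellLaw_nonneg (π := π) (S₀ \ {v, π v}) H (t + 2 * f) c x
      rw [show j + 1 - f = (j - f) + 1 by omega, pow_succ]
      calc βF ^ f * (βE ^ (j - f) * βE) * shellLaw π S' H t c (x - (w₁ : ℤ))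
          = βE * (βF ^ f * βE ^ (j - f) * shellLaw π S' H t c (x - (w₁ : ℤ))) := by ring
        _ ≤ βE * shellLaw π (S₀ \ {v, π v}) H (t + 2 * f) c x :=
            mul_le_mul_of_nonneg_left hIHx hβE0
        _ ≤ ((S₀.card : ℝ) - ((t + 2 * f : ℕ) : ℝ) - c) / S₀.card * shellLaw π (S₀ \ {v, π v}) H (t + 2 * f) c x :=
            mul_le_mul_of_nonneg_right hfac hlaw0
        _ ≤ shellLaw π S₀ H (t + 2 * f) c x := hstep

/-- **THE RE-INSERTION CHAIN with the explicit bases** (the form asked by cell pnp-psdrank's prover, MEMO-26 §7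
Step 5): for a fixed-point-free involution `π`, `π`-stable `S' ⊆ S₀` with `|S'| + 2j = |S₀|`, `f ≤ j`, levels `t, c`
with `0 ≤ t + 2 − c` and `0 ≤ |S'| + 2 − t − 2f − c`, and a block `H`: there is `w₀ ≤ 2f` with
`((t+2−c)/|S₀|)^f · ((|S'|+2−t−2f−c)/|S₀|)^{j−f} · law_{S'}(t,c; x − w₀) ≤ law_{S₀}(t+2f,c; x)` for every `x ∈ ℤ`.
(Use: `S₀ = univ`, `j = 2k`, `f = k`, `c = 1`, level `t − 2k`: the `2k`-fold deleted laws of the singleton-window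
level smoothing against the undeleted law, loss `β^{−2k}`, shift `≤ 2k`.) [cite: Rothvoss2017, §2 (PDF p. 6)] -/
theorem shellLaw_reinsertion_chain {S₀ S' : Finset (Fin n)} (hS₀ : ∀ u ∈ S₀, π u ∈ S₀)
    (hS' : ∀ u ∈ S', π u ∈ S') (hsub : S' ⊆ S₀) {j : ℕ} (hcard : S'.card + 2 * j = S₀.card)
    {f : ℕ} (hf : f ≤ j) (H : Finset (Fin n)) (t c : ℕ)
    (hF : 0 ≤ (t : ℝ) + 2 - c) (hE : 0 ≤ (S'.card : ℝ) + 2 - t - 2 * f - c) :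
    ∃ w₀ : ℕ, w₀ ≤ 2 * f ∧ ∀ x : ℤ,
      (((t : ℝ) + 2 - c) / S₀.card) ^ f * (((S'.card : ℝ) + 2 - t - 2 * f - c) / S₀.card) ^ (j - f) *
          shellLaw π S' H t c (x - (w₀ : ℤ)) ≤
        shellLaw π S₀ H (t + 2 * f) c x := by
  have hS₀0 : (0 : ℝ) ≤ S₀.card := Nat.cast_nonneg _
  refine shellLaw_reinsertion_le hπ hπ' H c (div_nonneg hF hS₀0) (div_nonneg hE hS₀0) j hS₀ hS' hsub hcard t f hf
    ?_ ?_
  · by_cases h0 : (S₀.card : ℝ) = 0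
    · rw [h0, mul_zero]; exact hF
    · rw [div_mul_cancel₀ _ h0]
  · by_cases h0 : (S₀.card : ℝ) = 0
    · rw [h0, mul_zero]; exact hE
    · rw [div_mul_cancel₀ _ h0]

end Reinsertion

end ShellStep

end Literature.Combinatorics.Optimization
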